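import Literature.AlgebraicGeometry.HodgeTheory.BettiHodgeConjectureProductsHodgeDisjointExamples
import Literature.AlgebraicGeometry.HodgeTheory.BettiHodgeGroupTrivialPureTypeDegrees
import Literature.AlgebraicGeometry.HodgeTheory.BettiIrregularityHodgeTateType
import HarnessLib

/-!
# The Hodge-disjoint product criteria in Hodge NUMBERS: `H^{p,q} = 0 ⟺ h^{p,q} = 0` on the Betti carriers; `HC(S × T)` unconditionally for [`q(S) = 0` or `h^{2,1}(T) = 0`] and [`p_g(S) = 0` or
# `h^{2,0}(T) = 0`]; `HC(C × X)` and `HC(S × X)` from `HC(X)` and vanishing Hodge numbers of `X`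
# (Voisin I §6.1.3 Cor. 6.13, §7.1.1, §11.3.3 Thm. 11.38–11.40, Lemma 11.41, pp. 285–287, Thm. 11.30; Voisin II §11.1.1, Prop. 9.20, proof of Prop. 10.26; Deligne Hodge II 1.2.5, 2.1.13)

Family `hodge`, lane `lit-hodgefound` (Track 2 foundations library; Layers A1/A4), layer `Literature/AlgebraicGeometry/HodgeTheory`.  THEOREMS ONLY (no definition, no named fact, no instance;
D-0026 net debt `0`).  The seat's g31-#16/#17 state the vanishing of Hodge types as `piece p q = ⊥` on the tree's `BettiUniverse.hodge` structures; the tree's earlier product theorems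
(`BettiUniverse.hodgeConjectureFor_surface_tensor_threefold_of_q_zero_of_h20_zero`, `…_tensor_curve_of_hodgeNumber_eq_zero`, `…_threefold_tensor_curve_of_h21_zero`) use Hodge NUMBERS
`hodgeNumber p q = 0`.  On the finite-dimensional Betti carriers the two agree (§1, `h^{p,q} = dim_ℂ H^{p,q}`), and this file restates the Hodge-disjoint criteria in Hodge numbers: §2 is the common
generalisation of the tree's `…_of_q_zero_of_h20_zero` (`q(S) = 0`, `h^{2,0}(T) = 0`) and of g31-#17 §3 — **`HC(S × T)` for every surface `S` and threefold `T` with [`q(S) = 0` or `h^{2,1}(T) = 0`] and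
[`p_g(S) = 0` or `h^{2,0}(T) = 0`]**, unconditionally; §3 is the `C × X` form (the factor order mirror to the tree's `BettiUniverse.hodgeConjectureFor_tensor_curve_of_hodgeNumber_eq_zero` for `X × C`,
as g31-#16 §3 mirrors `…_threefold_tensor_curve_of_h21_zero`); §4 the `S × X` form.  Conversions: `b₁ = 0 ⟺ h^{1,0} = 0` (tree `finrank_bettiCohomology_one_eq_zero_iff`), `Hdg¹(H²) = H²;ℚ ⟺
h^{2,0} = 0` (tree `hodgeClasses_hodge_two_eq_top_iff`).

WHAT IS PROVED.
* §1 **`BettiUniverse.piece_hodge_eq_bot_iff_hodgeNumber_eq_zero`** — `Hᵏ(X)^{p,q} = 0 ⟺ h^{p,q}(Hᵏ(X)) = 0`.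
* §2 **`BettiUniverse.hodgeConjectureFor_surface_tensor_threefold_of_hodgeNumber_eq_zero`** — `HC(S × T)` for [`h^{1,0}(S) = 0` or `h^{2,1}(T) = 0`] and [`h^{2,0}(S) = 0` or `h^{2,0}(T) = 0`].
* §3 **`BettiUniverse.hodgeConjectureFor_curve_tensor_of_forall_hodgeNumber_eq_zero`** — `HC(C × X)` from `HC(X)` and `h^{n+1−c, n−c}(H^{2n+1−2c}(X)) = 0`, `2 ≤ c`, `2c ≤ n + 1`.
* §4 **`BettiUniverse.hodgeConjectureFor_surface_tensor_of_forall_hodgeNumber_eq_zero`** — `HC(S × X)` from `HC(X)`, [`h^{1,0}(S) = 0` or those vanishings] and [`h^{2,0}(S) = 0` or `Hdgᵇ(H^{2b}(X)) = ⊤`,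
  `b + 1 = c`].

THE PRINTS.  C. Voisin (2002) [VoisinHodgeI2002] §6.1.3 Cor. 6.13; §7.1.1; §11.3.1 Thm. 11.30; §11.3.3 Thm. 11.38–11.40, Lemma 11.41 and pp. 285–287.  C. Voisin (2003) [VoisinHodgeII2003] §9.2.4 Prop. 9.20,
§10.2.3 proof of Prop. 10.26, §11.1.1.  P. Deligne (1971) [DeligneHodgeII1971] 1.2.5, 2.1.13.  P. Deligne (2000/2006) [Deligne2000] §1.

THE OBJECTS (all the tree's).  `BettiUniverse.hodge`, `HodgeStructure.piece`, `HodgeStructure.hodgeNumber`, `hodgeClasses`, `bettiCohomology`, `Module.finrank`, `HodgeConjectureFor`; the tree's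
`BettiUniverse.finite`, `BettiUniverse.finrank_bettiCohomology_one_eq_zero_iff`, `BettiUniverse.hodgeClasses_hodge_two_eq_top_iff`, the seat's g31-#17
`BettiUniverse.hodgeConjectureFor_curve_tensor_of_forall_piece_eq_bot`, `…_surface_tensor_of_forall_piece_eq_bot_of_forall_hodgeClasses_eq_top`, `…_surface_tensor_threefold_of_piece_two_one_eq_bot`.

DEVIATIONS / SCOPE.  Complex orientations (through g31-#14/#16).  No definitions.

## References
* [VoisinHodgeI2002] C. Voisin, *Hodge Theory and Complex Algebraic Geometry I* (2002) — §6.1.3 Cor. 6.13; §7.1.1; §11.3.1 Thm. 11.30; §11.3.3 Thm. 11.38–11.40, Lemma 11.41, pp. 285–287.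
* [VoisinHodgeII2003] C. Voisin, *Hodge Theory and Complex Algebraic Geometry II* (2003) — §9.2.4 Prop. 9.20; §10.2.3 proof of Prop. 10.26; §11.1.1.
* [DeligneHodgeII1971] P. Deligne, *Théorie de Hodge II* (1971) — 1.2.5, 2.1.13.
* [Deligne2000] P. Deligne, *The Hodge conjecture* (Clay problem description) — §1.

## Provenance
Lane `lit-hodgefound` (Hodge path, Track 2), prover seat `lit-hodgefound-p29` (generation 31), self-proposed row g31-#18 (Hodge-number phrasing of the Hodge-disjoint product criteria; bridges
to the tree's `hodgeNumber` conventions).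
-/

noncomputable section

open scoped TensorProduct
open CategoryTheory MonoidalCategory CartesianMonoidalCategory Module Finset
open Literature.AlgebraicTopology.SingularHomology
open Literature.Geometry.Kaehler

namespace Literature.AlgebraicGeometry.HodgeTheory

open Literature.AlgebraicGeometry.Motives
open Literature.AlgebraicGeometry.Motives.HodgeStructure

/-! ### §1 Vanishing of a Hodge type in Hodge numbers -/

/-- **`Hᵏ(X)^{p,q} = 0 ⟺ h^{p,q}(Hᵏ(X)) = 0`** on the tree's Betti carriers (`h^{p,q} = dim_ℂ H^{p,q}`, the pieces are finite-dimensional). [cite: VoisinHodgeI2002, §7.1.1] -/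
theorem BettiUniverse.piece_hodge_eq_bot_iff_hodgeNumber_eq_zero {n : ℕ} {X : SchemeOver ℂ} (hHD : exists_isReal_hodgeModel) (hX : IsSmoothProjective n X) (k : ℕ) (p q : ℤ) :
    (BettiUniverse.hodge hHD hX k).piece p q = ⊥ ↔ (BettiUniverse.hodge hHD hX k).hodgeNumber p q = 0 := by
  haveI := BettiUniverse.finite hX k
  unfold HodgeStructure.hodgeNumber
  exact Submodule.finrank_eq_zero.symm

variable {n d : ℕ} {C S T X : SchemeOver ℂ}

variable [HodgeTensorFacts.{0, 0}]

/-! ### §2 `S × T` in Hodge numbers -/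

/-- **`HC(S × T)`, unconditionally, for every smooth projective surface `S` and threefold `T` with [`h^{1,0}(S) = 0` or `h^{2,1}(T) = 0`] and [`h^{2,0}(S) = 0` or `h^{2,0}(T) = 0`]** — the common
generalisation of the tree's `BettiUniverse.hodgeConjectureFor_surface_tensor_threefold_of_q_zero_of_h20_zero` and of g31-#17 §3 (`b₁(S) = 0 ⟺ h^{1,0}(S) = 0`; `Hdg¹(H²) = H²;ℚ ⟺ h^{2,0} = 0`,
Lefschetz `(1,1)`). [cite: VoisinHodgeI2002, §6.1.3 Cor. 6.13, §7.1.1, §11.3.3 Thm. 11.38–11.40, Lemma 11.41 and pp. 285–287, §11.3.1 Thm. 11.30] [cite: VoisinHodgeII2003, §11.1.1, §9.2.4 Prop. 9.20, §10.2.3 proof of Prop. 10.26]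
[cite: Deligne2000, §1] -/
theorem BettiUniverse.hodgeConjectureFor_surface_tensor_threefold_of_hodgeNumber_eq_zero (hHD : exists_isReal_hodgeModel) (hS : IsSmoothProjective 2 S) (hT : IsSmoothProjective 3 T)
    (hST : IsSmoothProjective d (S ⊗ T)) (h1 : (BettiUniverse.hodge hHD hS 1).hodgeNumber 1 0 = 0 ∨ (BettiUniverse.hodge hHD hT 3).hodgeNumber 2 1 = 0)
    (h2 : (BettiUniverse.hodge hHD hS 2).hodgeNumber 2 0 = 0 ∨ (BettiUniverse.hodge hHD hT 2).hodgeNumber 2 0 = 0) : HodgeConjectureFor d (S ⊗ T) :=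
  BettiUniverse.hodgeConjectureFor_surface_tensor_threefold_of_piece_two_one_eq_bot hHD hS hT hST
    (h1.imp (fun h ↦ (BettiUniverse.finrank_bettiCohomology_one_eq_zero_iff hHD hS).2 h) fun h ↦ (BettiUniverse.piece_hodge_eq_bot_iff_hodgeNumber_eq_zero hHD hT 3 2 1).2 h)
    (h2.imp (fun h ↦ (BettiUniverse.hodgeClasses_hodge_two_eq_top_iff hHD hS).2 h) fun h ↦ (BettiUniverse.hodgeClasses_hodge_two_eq_top_iff hHD hT).2 h)

/-! ### §3 `C × X` in Hodge numbers -/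

/-- **`HC(C × X)` from `HC(X)` and `h^{n+1−c, n−c}(H^{2n+1−2c}(X)) = 0` for `2 ≤ c`, `2c ≤ n + 1`** (degree `a` and type `(P, Q)` bound by `a + 2c = 2n + 1`, `P + c = n + 1`, `Q + c = n`) — the
`C × X` order of the tree's `BettiUniverse.hodgeConjectureFor_tensor_curve_of_hodgeNumber_eq_zero` (stated there for `X × C`), here from g31-#17 §1. [cite: VoisinHodgeI2002, §7.1.1, §11.3.3 Lemma 11.41, p. 287, Thm. 11.30]
[cite: DeligneHodgeII1971, 1.2.5 and 2.1.13] [cite: Deligne2000, §1] -/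
theorem BettiUniverse.hodgeConjectureFor_curve_tensor_of_forall_hodgeNumber_eq_zero (hHD : exists_isReal_hodgeModel) (hC : IsSmoothProjective 1 C) (hX : IsSmoothProjective n X)
    (hCX : IsSmoothProjective d (C ⊗ X)) (hHCX : HodgeConjectureFor n X)
    (h : ∀ (c a : ℕ) (P Q : ℤ), 2 ≤ c → 2 * c ≤ n + 1 → a + 2 * c = 2 * n + 1 → P + ((c : ℕ) : ℤ) = ((n : ℕ) : ℤ) + 1 → Q + ((c : ℕ) : ℤ) = ((n : ℕ) : ℤ) →
      (BettiUniverse.hodge hHD hX a).hodgeNumber P Q = 0) :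
    HodgeConjectureFor d (C ⊗ X) :=
  BettiUniverse.hodgeConjectureFor_curve_tensor_of_forall_piece_eq_bot hHD hC hX hCX hHCX fun c a P Q hc hc' ha hP hQ ↦
    (BettiUniverse.piece_hodge_eq_bot_iff_hodgeNumber_eq_zero hHD hX a P Q).2 (h c a P Q hc hc' ha hP hQ)

/-! ### §4 `S × X` in Hodge numbers -/

/-- **`HC(S × X)` from `HC(X)`, [`h^{1,0}(S) = 0` or `h^{n+1−c, n−c}(H^{2n+1−2c}(X)) = 0` for `2 ≤ c`, `2c ≤ n + 1`] and [`h^{2,0}(S) = 0` or `Hdgᵇ(H^{2b}(X)) = H^{2b}(X;ℚ)` for `b + 1 = c`, `2 ≤ c`,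
`2c ≤ n + 2`]** (g31-#17 §2 in Hodge numbers). [cite: VoisinHodgeI2002, §6.1.3 Cor. 6.13, §7.1.1, §11.3.3 Lemma 11.41, p. 287, Thm. 11.30] [cite: VoisinHodgeII2003, §11.1.1, §9.2.4 Prop. 9.20] [cite: DeligneHodgeII1971, 2.1.13]
[cite: Deligne2000, §1] -/
theorem BettiUniverse.hodgeConjectureFor_surface_tensor_of_forall_hodgeNumber_eq_zero (hHD : exists_isReal_hodgeModel) (hS : IsSmoothProjective 2 S) (hX : IsSmoothProjective n X)
    (hSX : IsSmoothProjective d (S ⊗ X)) (hHCX : HodgeConjectureFor n X)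
    (h1 : ∀ (c a : ℕ) (P Q : ℤ), 2 ≤ c → 2 * c ≤ n + 1 → a + 2 * c = 2 * n + 1 → P + ((c : ℕ) : ℤ) = ((n : ℕ) : ℤ) + 1 → Q + ((c : ℕ) : ℤ) = ((n : ℕ) : ℤ) →
      (BettiUniverse.hodge hHD hS 1).hodgeNumber 1 0 = 0 ∨ (BettiUniverse.hodge hHD hX a).hodgeNumber P Q = 0)
    (h2 : ∀ c b : ℕ, 2 ≤ c → 2 * c ≤ n + 2 → b + 1 = c → (BettiUniverse.hodge hHD hS 2).hodgeNumber 2 0 = 0 ∨ (BettiUniverse.hodge hHD hX (2 * b)).hodgeClasses b = ⊤) :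
    HodgeConjectureFor d (S ⊗ X) :=
  BettiUniverse.hodgeConjectureFor_surface_tensor_of_forall_piece_eq_bot_of_forall_hodgeClasses_eq_top hHD hS hX hSX hHCX
    (fun c a P Q hc hc' ha hP hQ ↦ (h1 c a P Q hc hc' ha hP hQ).imp (fun h ↦ (BettiUniverse.finrank_bettiCohomology_one_eq_zero_iff hHD hS).2 h)
      fun h ↦ (BettiUniverse.piece_hodge_eq_bot_iff_hodgeNumber_eq_zero hHD hX a P Q).2 h)
    fun c b hc hc' hb ↦ (h2 c b hc hc' hb).imp (fun h ↦ (BettiUniverse.hodgeClasses_hodge_two_eq_top_iff hHD hS).2 h) id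

end Literature.AlgebraicGeometry.HodgeTheory

end
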